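import Mathlib.RingTheory.Ideal.Span
import Mathlib.RingTheory.Ideal.MinimalPrime.Basic
import Mathlib.RingTheory.LocalRing.Basic
import Mathlib.RingTheory.Nilpotent.Lemmas
import Mathlib.RingTheory.PrincipalIdealDomain
import Mathlib.Tactic.LinearCombination
import Mathlib.Tactic.Ring
import HarnessLib

/-!
# T-USELESS / T-USEFUL: the trace on `H = {στ = 0}` of a curvilinear `m`-fold structure `Z = (σ − a(τ), τ^m)`

[OURS · L1 W4.5(b)] Helper for the research stub `stub_elnat_three_nonisolated` of the crux `EquisingularLiftNat`
(stmt-ResolutionOfSingularities-20038; route `EquisingularLift`, chain w45b; res-L1-w45b-lead-2 LEAD-MEMO-1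
sha16 438b5e61c3cbba83, §3 bullet 4 «(M) USEFUL ⇔ SHEET-TANGENT» and §5 «T-USELESS/USEFUL (S each): the two ideal
computations of §3 in `k[[σ,τ]]/(στ)` (disprover-side documentation of (M))»). NOT a statement of any manuscript;
AI-written kernel lemmas of the cell `res-hironaka` (weaker than expert review). Typed by res-type-004.

**The situation (informal).** At a general point `P` of a double curve `Σ` of the surface `H ⊂ ℙ³_k`, `H` has two
smooth sheets crossing normally: `𝒪_{H,P} ⊇ (σ, τ)` with `στ = 0`, `Σ = {σ = τ = 0}`. The special fibre `Z = C_k` of a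
horizontal regular centre `C` touching `Σ` with multiplicity `m` is the curvilinear structure
`I_Z = (σ − a(τ), τ^m)` carried by a smooth surface germ `G = {σ = a(τ)} ⊃ Σ` (`a ∈ (τ)`); write `a = τ^r · w`
with `w` a unit of the local ring (`r = ord_τ a ≥ 1`; at a general point of `Σ` the leading coefficient of `a` along
`Σ` is a unit). The blow-up of `H` along `Z` is an isomorphism near `P` iff the trace `I_Z · 𝒪_{H,P}` is invertible.

**Proved here** (pure commutative algebra, `[folklore]` level; the objects are pinned by the equational hypotheses
`σ * τ = 0`, `a = τ ^ r * w` — no definitions):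
* `pow_mem_span_singleton_sub` (T-USELESS core) — in ANY commutative ring with `στ = 0`, `w` a unit and
  `r + 1 ≤ m`: `τ^m ∈ (σ − τ^r w)`; explicitly `τ^m = −τ^{m−r} w⁻¹ · (σ − τ^r w)` (the memo's
  «`τ^m = (σ − a(τ))·(−τ^{m−1}/a′(0)·unit) mod στ`» is the case `r = 1`). Hence
  `span_pair_eq_span_singleton_sub` / `isPrincipal_span_pair_of_lt`: `I_Z·𝒪_H = (σ − a)` is principal, and by
  `mem_nonZeroDivisors_of_forall_minimalPrimes` it is generated by a non-zero-divisor as soon as `σ − a` avoids the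
  minimal primes of the (reduced) ring — USELESS centre.
* `span_pair_eq_span_pair_of_dvd` (in-sheet reformulation) — if `τ^m ∣ a` then `(σ − a, τ^m) = (σ, τ^m)`:
  the structure `Z` IS the `m`-fold thickening of `Σ` inside the sheet `{σ = 0}`.
* `not_isPrincipal_span_pair` (T-USEFUL core) — in a LOCAL ring with `στ = 0`, `τ^{m+1} ≠ 0` and `σ ∉ (τ^m)`:
  `(σ, τ^m)` is NOT principal (so not invertible: the centre is useful). Locality is needed: in `k × k` with
  `σ = (1,0)`, `τ = (0,1)` the same hypotheses hold and `(σ, τ^m) = ⊤`.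
* `isPrincipal_span_pair_iff` (the sharp dichotomy, local ring, `w` unit, `στ = 0`, `τ^{m+1} ≠ 0`, `σ ∉ (τ^m)`):
  `(σ − τ^r w, τ^m)` is principal **iff `r + 1 ≤ m`**. In particular (`le_of_not_isPrincipal`, any ring) a USEFUL
  structure has `m ≤ r = ord_τ a`, i.e. `G` osculates the sheet `{σ = 0}` to order `≥ m − 1` along `Σ` and `Z ⊂ {σ = 0}`;
  for `m ≥ 2` this contains the memo's necessary condition «useful needs `a′(0) = 0`» (`G` tangent to a sheet), which is
  what forces a rational section of the sheet double cover `D → Σ` in LEAD-MEMO-1 §3.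

What is NOT here: the geometric dictionary (`Z = C_k`, blow-up iso ⇔ invertible trace ideal), the passage «general point
of `Σ` ⇒ `w` unit», and any power-series model (the lemmas apply verbatim in `𝒪_{H,P}`, in its completion
`k[[σ,τ,z]]/(στ)`, and in `k[[σ,τ]]/(στ)`). References: folklore commutative algebra; the lead's hand computation
LEAD-MEMO-1 §3 (cell-internal; sharpened here from «`a′(0) ≠ 0` ⇒ useless» to «useless ⇔ `ord_τ a < m`»).
-/

-- single-problem summit: the doubled namespace component `ResolutionOfSingularities` is forced
set_option linter.dupNamespace false

namespace Summit.ResolutionOfSingularities.ResolutionOfSingularities.Cruxes.EquisingularLiftNat.Sections.SheetTangent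

section AnyRing

variable {S : Type*} [CommRing S]

/-- **T-USELESS, the identity.** In any commutative ring with `σ * τ = 0`: for a unit `w` and `r + 1 ≤ m`,
`-(τ ^ (m - r) * w⁻¹) * (σ - τ ^ r * w) = τ ^ m` (the `σ`-term dies because it contains `στ`, the `τ`-term is
`τ^m · w⁻¹ w`). LEAD-MEMO-1 §3: «`τ^m = (σ − a(τ))·(−τ^{m−1}/a′(0)·unit) mod στ`» (`r = 1`). [folklore] -/
theorem neg_mul_sub_eq_pow (σ τ : S) (w : Sˣ) {r m : ℕ} (hστ : σ * τ = 0) (hm : r + 1 ≤ m) :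
    -(τ ^ (m - r) * ↑w⁻¹) * (σ - τ ^ r * ↑w) = τ ^ m := by
  obtain ⟨d, rfl⟩ : ∃ d, m = r + 1 + d := ⟨m - (r + 1), by omega⟩
  have hsub : r + 1 + d - r = d + 1 := by omega
  rw [hsub]
  linear_combination (-(τ ^ d * (↑w⁻¹ : S))) * hστ + τ ^ (r + 1 + d) * w.inv_mul

/-- **T-USELESS (core).** In any commutative ring with `σ * τ = 0`: if `w` is a unit and `r + 1 ≤ m` then
`τ ^ m ∈ (σ − τ^r w)`. Reading: at a normal-crossings point of the double curve (`𝒪_H ∋ σ, τ`, `στ = 0`), the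
curvilinear structure `Z = (σ − a, τ^m)` with `ord_τ a = r < m` has trace `I_Z·𝒪_H = (σ − a)`. [folklore] -/
theorem pow_mem_span_singleton_sub (σ τ w : S) {r m : ℕ} (hστ : σ * τ = 0) (hw : IsUnit w) (hm : r + 1 ≤ m) :
    τ ^ m ∈ Ideal.span {σ - τ ^ r * w} := by
  obtain ⟨u, rfl⟩ := hw
  exact Ideal.mem_span_singleton'.2 ⟨_, neg_mul_sub_eq_pow σ τ u hστ hm⟩

/-- **T-USELESS (the trace ideal collapses).** Under the hypotheses of `pow_mem_span_singleton_sub`,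
`(σ − τ^r w, τ^m) = (σ − τ^r w)`: the trace of `I_Z` on `H` is the principal ideal of the carrying germ. [folklore] -/
theorem span_pair_eq_span_singleton_sub (σ τ w : S) {r m : ℕ} (hστ : σ * τ = 0) (hw : IsUnit w)
    (hm : r + 1 ≤ m) :
    Ideal.span {σ - τ ^ r * w, τ ^ m} = Ideal.span {σ - τ ^ r * w} := by
  refine le_antisymm ?_ (Ideal.span_mono (Set.singleton_subset_iff.2 (Set.mem_insert _ _)))
  rw [Ideal.span_le]
  rintro x (rfl | rfl)
  · exact Ideal.mem_span_singleton_self _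
  · exact pow_mem_span_singleton_sub σ τ w hστ hw hm

/-- **T-USELESS (principal).** Under the hypotheses of `pow_mem_span_singleton_sub` the trace ideal
`(σ − τ^r w, τ^m)` is principal. [folklore] -/
theorem isPrincipal_span_pair_of_lt (σ τ w : S) {r m : ℕ} (hστ : σ * τ = 0) (hw : IsUnit w)
    (hm : r + 1 ≤ m) : (Ideal.span {σ - τ ^ r * w, τ ^ m}).IsPrincipal := by
  rw [span_pair_eq_span_singleton_sub σ τ w hστ hw hm]
  exact ⟨⟨σ - τ ^ r * w, rfl⟩⟩

/-- **Non-zero-divisor test for the generator** (so that «principal» upgrades to «invertible»). In a reduced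
commutative ring, an element lying in no minimal prime is a non-zero-divisor: if `x * y = 0` then `y` lies in every
minimal prime, i.e. in the nilradical `= 0`. Reading: `𝒪_{H,P} = R/(στ)` is reduced with minimal primes `(σ)`, `(τ)`,
and `σ − τ^r w` (`r ≥ 1`, `w` unit) lies in neither, so the USELESS trace ideal `(σ − τ^r w)` is invertible and the
blow-up of `H` along `Z` is an isomorphism near `P`. [folklore] -/
theorem mem_nonZeroDivisors_of_forall_minimalPrimes [IsReduced S] (x : S)
    (hx : ∀ p ∈ minimalPrimes S, x ∉ p) : x ∈ nonZeroDivisors S := by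
  refine (mem_nonZeroDivisors_iff_right).2 fun y hy => ?_
  have hy' : y ∈ sInf (minimalPrimes S) := by
    rw [Ideal.mem_sInf]
    intro p hpmin
    have hprime : p.IsPrime := hpmin.1.1
    have hxy : y * x ∈ p := by rw [hy]; exact p.zero_mem
    exact (hprime.mem_or_mem hxy).resolve_right (hx p hpmin)
  rw [minimalPrimes, Ideal.sInf_minimalPrimes, Ideal.mem_radical_iff] at hy'
  obtain ⟨n, hn⟩ := hy'
  exact IsNilpotent.eq_zero ⟨n, hn⟩

/-- **In-sheet reformulation.** In any commutative ring: if `τ^m ∣ a` then `(σ − a, τ^m) = (σ, τ^m)` — a curvilinear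
structure whose carrying germ `{σ = a(τ)}` osculates the sheet `{σ = 0}` to order `≥ m − 1` IS the `m`-fold thickening
of `Σ` inside that sheet. [folklore] -/
theorem span_pair_eq_span_pair_of_dvd (σ τ a : S) {m : ℕ} (h : τ ^ m ∣ a) :
    Ideal.span {σ - a, τ ^ m} = Ideal.span {σ, τ ^ m} := by
  obtain ⟨c, rfl⟩ := h
  refine le_antisymm ?_ ?_
  · rw [Ideal.span_le]
    rintro x (rfl | rfl)
    · exact Ideal.mem_span_pair.2 ⟨1, -c, by ring⟩
    · exact Ideal.mem_span_pair.2 ⟨0, 1, by ring⟩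
  · rw [Ideal.span_le]
    rintro x (rfl | rfl)
    · exact Ideal.mem_span_pair.2 ⟨1, c, by ring⟩
    · exact Ideal.mem_span_pair.2 ⟨0, 1, by ring⟩

/-- **Necessity of in-sheet osculation for usefulness** (contrapositive of T-USELESS, any commutative ring with
`στ = 0`, `w` a unit): if the trace ideal `(σ − τ^r w, τ^m)` is NOT principal then `m ≤ r`. For `m ≥ 2` (the case (M)
of LEAD-MEMO-1 §3) this contains «useful needs `a′(0) = 0`», i.e. the carrying germ is tangent to a sheet. [folklore] -/
theorem le_of_not_isPrincipal (σ τ w : S) {r m : ℕ} (hστ : σ * τ = 0) (hw : IsUnit w)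
    (h : ¬ (Ideal.span {σ - τ ^ r * w, τ ^ m}).IsPrincipal) : m ≤ r := by
  by_contra hlt
  exact h (isPrincipal_span_pair_of_lt σ τ w hστ hw (by omega))

end AnyRing

section LocalRing

variable {O : Type*} [CommRing O] [IsLocalRing O]

/-- **T-USEFUL (core).** In a LOCAL commutative ring with `σ * τ = 0`, `τ ^ (m+1) ≠ 0` and `σ ∉ (τ^m)`, the ideal
`(σ, τ^m)` is not principal. Proof: if `(σ, τ^m) = (f)` with `f = ασ + βτ^m`, `τ^m = δf`, then
`(1 − δβ)τ^m = δασ`; if `1 − δβ` is a unit, multiplying by `τ` gives `τ^{m+1} = 0`; otherwise `δβ`, hence `δ`, is a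
unit (local ring), `f ∈ (τ^m)` and `σ ∈ (f) ⊆ (τ^m)`. Reading: for `𝒪_{H,P}` at a normal-crossings point of the
double curve, the `m`-fold thickening of `Σ` inside a sheet has a non-invertible trace on `H` — the centre is USEFUL
(`Bl_Z H ≠ H` near `P`). Locality is necessary (`k × k`, `σ = (1,0)`, `τ = (0,1)`: `(σ, τ^m) = ⊤`). [folklore] -/
theorem not_isPrincipal_span_pair (σ τ : O) {m : ℕ} (hστ : σ * τ = 0) (hτ : τ ^ (m + 1) ≠ 0)
    (hσ : σ ∉ Ideal.span {τ ^ m}) : ¬ (Ideal.span {σ, τ ^ m}).IsPrincipal := by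
  intro hP
  set I : Ideal O := Ideal.span {σ, τ ^ m} with hI
  set f : O := Submodule.IsPrincipal.generator I with hf
  have hIf : I = Ideal.span {f} := (Ideal.span_singleton_generator I).symm
  have hfI : f ∈ I := by rw [hIf]; exact Ideal.subset_span rfl
  have hσI : σ ∈ Ideal.span {f} := by rw [← hIf]; exact Ideal.subset_span (by simp)
  have hτI : τ ^ m ∈ Ideal.span {f} := by rw [← hIf]; exact Ideal.subset_span (by simp)
  obtain ⟨α, β, hαβ⟩ := Ideal.mem_span_pair.1 hfI
  obtain ⟨γ, hγ⟩ := Ideal.mem_span_singleton'.1 hσI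
  obtain ⟨δ, hδ⟩ := Ideal.mem_span_singleton'.1 hτI
  -- `(1 - δβ) τ^m = δ α σ`
  have key : (1 - δ * β) * τ ^ m = δ * α * σ := by
    linear_combination (-1 : O) * hδ + (-δ) * hαβ
  rcases IsLocalRing.isUnit_or_isUnit_one_sub_self (δ * β) with hu | hu
  · -- `δ` is a unit: `f = δ⁻¹ τ^m`, so `σ = γ f ∈ (τ^m)`
    obtain ⟨δu, hδu⟩ := (isUnit_of_mul_isUnit_left hu)
    apply hσ
    refine Ideal.mem_span_singleton'.2 ⟨γ * ↑δu⁻¹, ?_⟩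
    have hf' : f = ↑δu⁻¹ * τ ^ m := by
      rw [← hδ, ← hδu, ← mul_assoc, Units.inv_mul, one_mul]
    rw [mul_assoc, ← hf', hγ]
  · -- `1 - δβ` is a unit: `τ^m ∈ (σ)`, so `τ^(m+1) = 0`
    obtain ⟨v, hv⟩ := hu
    apply hτ
    have h1 : τ ^ m = ↑v⁻¹ * (δ * α * σ) := by
      rw [← key, ← hv, ← mul_assoc, Units.inv_mul, one_mul]
    calc τ ^ (m + 1) = τ ^ m * τ := pow_succ τ m
      _ = ↑v⁻¹ * (δ * α) * (σ * τ) := by rw [h1]; ring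
      _ = 0 := by rw [hστ, mul_zero]

/-- **T-USEFUL (in the carrying-germ coordinates).** Local ring, `στ = 0`, `τ^{m+1} ≠ 0`, `σ ∉ (τ^m)`: if `τ^m ∣ a`
(the carrying germ `{σ = a}` osculates the sheet `{σ = 0}` to order `≥ m − 1`) then the trace ideal `(σ − a, τ^m)` is
not principal — the centre is useful. [folklore] -/
theorem not_isPrincipal_span_pair_sub_of_dvd (σ τ a : O) {m : ℕ} (hστ : σ * τ = 0) (hτ : τ ^ (m + 1) ≠ 0)
    (hσ : σ ∉ Ideal.span {τ ^ m}) (ha : τ ^ m ∣ a) : ¬ (Ideal.span {σ - a, τ ^ m}).IsPrincipal := by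
  rw [span_pair_eq_span_pair_of_dvd σ τ a ha]
  exact not_isPrincipal_span_pair σ τ hστ hτ hσ

/-- **THE DICHOTOMY «USELESS ⇔ `ord_τ a < m`».** In a local commutative ring with `σ * τ = 0`, `τ^{m+1} ≠ 0`,
`σ ∉ (τ^m)`, and `w` a unit: the trace ideal `(σ − τ^r w, τ^m)` of the curvilinear `m`-fold structure carried by
`{σ = τ^r w}` is principal iff `r + 1 ≤ m`. So the ONLY useful curvilinear `m`-structures at a normal-crossings point of
the double curve are the `m`-fold thickenings of `Σ` inside one of the two sheets (`span_pair_eq_span_pair_of_dvd`);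
this sharpens LEAD-MEMO-1 §3 «(M) USEFUL ⇔ SHEET-TANGENT» (there: useful ⇒ `a′(0) = 0`). [folklore] -/
theorem isPrincipal_span_pair_iff (σ τ w : O) {r m : ℕ} (hστ : σ * τ = 0) (hτ : τ ^ (m + 1) ≠ 0)
    (hσ : σ ∉ Ideal.span {τ ^ m}) (hw : IsUnit w) :
    (Ideal.span {σ - τ ^ r * w, τ ^ m}).IsPrincipal ↔ r + 1 ≤ m := by
  refine ⟨fun h => ?_, isPrincipal_span_pair_of_lt σ τ w hστ hw⟩
  by_contra hlt
  have hdvd : τ ^ m ∣ τ ^ r * w := Dvd.dvd.mul_right (pow_dvd_pow τ (by omega)) w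
  exact not_isPrincipal_span_pair_sub_of_dvd σ τ (τ ^ r * w) hστ hτ hσ hdvd h

end LocalRing

end Summit.ResolutionOfSingularities.ResolutionOfSingularities.Cruxes.EquisingularLiftNat.Sections.SheetTangent
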